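import Summits.AtomisticToContinuum.Crystallization.Theorems.FrustratedLawDichotomyStrainedPatchHomPruned
import Summits.AtomisticToContinuum.Crystallization.Theorems.FrustratedLawDichotomyStrainedPatchHomIsometry

/-!
# `(H) HomFloor m` from pruned box sums over the POLAR FACTOR only — the certificate's top-level statement in U-coordinates
# (27623 strained-patch piece; decomp-a2c, prover hands 1 + 2, generation 20; critic rows 764 (C), 765 (g3) pre-assembly, 769)

Composition BY NAME of the two hands' files: hand-2's binding target `…HomPruned.homFloor_of_prunedBoxSums` (per `G` with `‖G − 1‖ ≤ 1/4`:
prune disjunct ∨ literal box floor, both families) and hand-1's O(3) reductions `…HomIsometry.prunedBoxSum_fcc_reduction / _hcp_reduction`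
(every `G` is `R ∘ U` with `R` a linear isometry and `U` self-adjoint positive, `‖U − 1‖ ≤ 1/4`; prune disjunct and box floor are `R`-invariant).
Result: ★ `homFloor_of_prunedBoxSums_selfAdjoint` — it suffices to certify, for every SELF-ADJOINT POSITIVE `U` with `‖U − 1‖ ≤ 1/4`
(6 coordinates; Gram `C = U²`), and every shuffle `‖ξ‖ ≤ 1/4` for hcp, EITHER the prune disjunct (tight ∨ exempt ∨ bad centre ball — supplied from
leaf data by `pruneFcc/Hcp_of_forceOut / _of_centre_good / _of_intruders / _of_radialSpread`) OR the box-floor inequality over `[−7,7]³`.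
(hand-1's hcp disjunct omits the `¬Sep` escape that `…HomPruned` allows; the adapter is `Or.inr`.)

0 sorry; no definitions; axioms ⊆ {propext, Classical.choice, Quot.sound}.  `--supports stmt-AtomisticToContinuum-27623`.
-/

noncomputable section

namespace Summit.AtomisticToContinuum.Crystallization.Theorems.FrustratedLawDichotomyStrainedPatchHomPrunedPolar

open scoped BigOperators Classical
open Summit.AtomisticToContinuum.Crystallization.Theorems.ChargedEnergyGapNegative (E3)
open Summit.AtomisticToContinuum.Crystallization.Theorems.FrustratedLawDichotomyRangeCut (Sep)
open Summit.AtomisticToContinuum.Crystallization.Theorems.FrustratedLawDichotomySchurCut (effPot w₄₅ ω₄)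
open Summit.AtomisticToContinuum.Crystallization.Theorems.FrustratedLawDichotomyAveragingRuleTightFree (TightNearCap BadNearCap)
open Summit.AtomisticToContinuum.Crystallization.Theorems.FrustratedLawDichotomyExemptAbsorption (ExemptNear)
open Summit.AtomisticToContinuum.Crystallization.Theorems.FrustratedLawDichotomyStrainedPatchHomSplit
open Summit.AtomisticToContinuum.Crystallization.Theorems.FrustratedLawDichotomyStrainedPatchHomPruned
open Summit.AtomisticToContinuum.Crystallization.Theorems.FrustratedLawDichotomyStrainedPatchHomIsometry
open Literature.Barriers.AtomisticToContinuum.FlatleyTheil2015 (fccVec)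

/-- ★★★ **`(H)` FROM PRUNED BOX SUMS OVER SELF-ADJOINT POSITIVE `U` ONLY** (`‖U − 1‖ ≤ 1/4`; hcp additionally `‖ξ‖ ≤ 1/4`).  This is the
statement a branch-and-bound certificate in polar / Gram coordinates establishes leaf by leaf; its two hypotheses are literally those of
`…HomIsometry.prunedBoxSum_fcc_reduction / _hcp_reduction` at the record data (frame `fccVec` / `hexFrame`, shift `hcpShift`, radius `133/10`,
box `[−7,7]³`, `W₄₅ = effPot w₄₅ ω₄ (3/400)`, `e_W = −0.7175 + 3/400`). [folklore] -/
theorem homFloor_of_prunedBoxSums_selfAdjoint {m : ℝ}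
    (hfcc : ∀ U : E3 →L[ℝ] E3, (∀ v w : E3, inner ℝ (U v) w = inner ℝ v (U w)) → (∀ w : E3, 0 ≤ inner ℝ w (U w)) → ‖U - 1‖ ≤ 1 / 4 →
      (∀ (M : ℕ) (z : Fin M → E3) (c : Fin M), Function.Injective z →
          Set.range z = {x : E3 | dist x (z c) ≤ 133 / 10 ∧ ∃ a : Fin 3 → ℤ, x = z c + latPt U fccVec a} →
          TightNearCap (9 / 5) (3 / 2) z c ∨ ExemptNear (9 / 5) ExRec z c ∨ BadNearCap (9 / 5) (3 / 2) z c) ∨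
      m ≤ (∑ b ∈ (Fintype.piFinset fun _ : Fin 3 => Finset.Icc (-7 : ℤ) 7).filter (fun b => b ≠ 0),
        effPot w₄₅ ω₄ (3 / 400) ‖latPt U fccVec b‖) / 2 - (-(7175 / 10000) + 3 / 400))
    (hhcp : ∀ (U : E3 →L[ℝ] E3) (ξ : E3), (∀ v w : E3, inner ℝ (U v) w = inner ℝ v (U w)) → (∀ w : E3, 0 ≤ inner ℝ w (U w)) →
      ‖U - 1‖ ≤ 1 / 4 → ‖ξ‖ ≤ 1 / 4 →
      (∀ (M : ℕ) (z : Fin M → E3) (c : Fin M), Function.Injective z →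
          Set.range z = {x : E3 | dist x (z c) ≤ 133 / 10 ∧ ∃ a : Fin 3 → ℤ,
            x = z c + latPt U hexFrame a ∨ x = z c + latPt U hexFrame a + U (hcpShift + ξ)} →
          TightNearCap (9 / 5) (3 / 2) z c ∨ ExemptNear (9 / 5) ExRec z c ∨ BadNearCap (9 / 5) (3 / 2) z c) ∨
      m ≤ (∑ b ∈ (Fintype.piFinset fun _ : Fin 3 => Finset.Icc (-7 : ℤ) 7).filter (fun b => b ≠ 0),
          effPot w₄₅ ω₄ (3 / 400) ‖latPt U hexFrame b‖ +
        ∑ b ∈ (Fintype.piFinset fun _ : Fin 3 => Finset.Icc (-7 : ℤ) 7),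
          effPot w₄₅ ω₄ (3 / 400) ‖latPt U hexFrame b + U (hcpShift + ξ)‖) / 2 - (-(7175 / 10000) + 3 / 400)) :
    HomFloor m :=
  homFloor_of_prunedBoxSums (prunedBoxSum_fcc_reduction hfcc) fun G ξ hG hξ =>
    (prunedBoxSum_hcp_reduction hhcp G ξ hG hξ).imp (fun h M z c hz hr => Or.inr (h M z c hz hr)) id

end Summit.AtomisticToContinuum.Crystallization.Theorems.FrustratedLawDichotomyStrainedPatchHomPrunedPolar

end
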